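import Mathlib
import Literature.Analysis.InnerProduct.CourantFischerBounds
import Literature.Analysis.InnerProduct.CholeskyResidualEigenvalueBounds

/-!
# Venture YMGap, track Y3 FLOW-DATA — the RITZ / DEFLATION block certificate of lineage A (flow-eng-1), typed

HONEST FRAMING: venture file of the cell `pub-ymgap` (QuantumFields programme), track Y3.  Lineage A (flow-eng-1,
engine «sntm», ENGINE.md §3 (iii)) certifies, for every symmetry block of the kept-set Galerkin matrix `G` of the
SU(2) Wilson transfer matrix, enclosures of the `k` LARGEST eigenvalues `λ↓₀ ≥ λ↓₁ ≥ … ≥ λ↓_{k-1}` of the EXACT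
block `G` from a floating-point build `M` of it:

* build rounding: `|G − M| ≤ N` entrywise (a `|·|`-accumulation bound) with row sums `≤ errG`
  ⇒ `|λ↓_i(G) − λ↓_i(M)| ≤ errG` (Schur test + Weyl) — `abs_eigenvalues₀_sub_le_of_entrywise`;
* LOWER bounds (Rayleigh–Ritz on the `i + 1` leading float Ritz vectors `W`, not assumed orthonormal):
  `Wᴴ W ≻ 0` and `Wᴴ M W − σ · Wᴴ W ⪰ 0` ⇒ `σ ≤ λ↓_i(M)` — `le_eigenvalues₀_of_ritz_posSemidef`
  (the certificate form of "every Ritz value of the pencil `(Wᴴ M W, Wᴴ W)` is `≥ σ`");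
* UPPER bounds (shifted, deflated positive semidefiniteness): `μ · 1 − M + Σ_{l<k} c_l · v_l v_lᴴ ⪰ 0` for SOME
  real `c_l` and vectors `v_l` ⇒ `λ↓_i(M) ≤ μ` for every `i ≥ k` — `eigenvalues₀_le_of_deflation_posSemidef`
  (the tree's `Matrix.IsHermitian.le_eigenvalues₀_of_deflation_posSemidef` is the mirror statement for the
  SMALLEST eigenvalues; the transfer-matrix rows need the largest);
* the positive (semi)definiteness itself from a Cholesky factor `R` of the shifted matrix with an entrywise
  dominated residual, `|C − δ·1 − Rᴴ R| ≤ N`, row/column sums of `N` at most `r ≤ δ` ⇒ `C ⪰ 0`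
  — `posSemidef_of_shifted_factor_residual`; and its transport from the matrix FORMED in floating point to the intended
  exact one through an entrywise-dominated difference — `posSemidef_of_entrywise_close`;
* ASSEMBLY `block_enclosure`: the three steps give `σ − errG ≤ λ↓_i(G) ≤ μ + errG`;
* BRACKETING builds (ENGINE.md §3 (ii)): `G⁻ ⪯ G ⪯ G⁺` in the Loewner order ⇒ `λ↓_i(G⁻) ≤ λ↓_i(G) ≤ λ↓_i(G⁺)`
  — `eigenvalues₀_mono` / `eigenvalues₀_sandwich`; with the certificates run on float builds of `G⁻` (lower) and
  `G⁺` (upper) this is `bracketed_block_enclosure`: `σ − errG⁻ ≤ λ↓_i(G) ≤ μ + errG⁺` for the never-assembled exact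
  kept-set block `G` — the `[lo_k(G⁻), hi_k(G⁺)]` of a task JSON;
* the kinetic-truncation tail (ENGINE.md §3 (i)) is the typed `Summit.Ventures.YMGap.FlowData.KWeightTail.eigenvalues₀_mem_Icc`
  (same object, `Ω = (e^β/c₀)^{N_sp}`); `row_enclosure` records the final composition `[lo, hi + κ_T Ω]`, and the
  plaquette rows use `SecantConvexCertificate` on top of these enclosures.

Pure finite-dimensional linear algebra over an `RCLike` field (the engine's matrices are real symmetric); every
statement is for Mathlib's antitone enumeration `Matrix.IsHermitian.eigenvalues₀`.  The IEEE-arithmetic facts that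
produce the dominating matrices `N` (`γ_n` accumulation bounds, Higham Thm. 10.3 for the Cholesky residual) are NOT
formalised: they enter as the hypotheses `hdom`, exactly as in the lineage-B file `EigenRadiusCertificate`.  No lattice
object, no number, no row, nothing about limits or a mass gap.

References: R. A. Horn, C. R. Johnson, *Matrix Analysis*, 2nd ed. (2013), Thm. 4.2.6 (Courant–Fischer), Cor. 4.3.9,
Thm. 4.3.21 / Cor. 4.3.37 (Rayleigh–Ritz, Poincaré separation), Thm. 4.3.1 (Weyl) [cite: HornJohnson2013, Thm 4.2.6;
Cor 4.3.9; Thm 4.3.21; Thm 4.3.1]; S. M. Rump, *Verification of positive definiteness*, BIT 46 (2006) Thm. 2.3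
[cite: Rump2006, Thm 2.3]; the cell's HOME/pub-ymgap-flow-eng-1/ENGINE.md §3 and `sntm/kit_build.py:cert_eigs`
(2026-08-22/23).
-/

noncomputable section

open Matrix Finset WithLp Module
open scoped InnerProductSpace ComplexOrder BigOperators

namespace Summit.Ventures.YMGap.FlowData

namespace RitzDeflation

open Literature.Analysis.InnerProduct

/-! ### §1 Operator form: an upper bound for the large eigenvalues from a form bound off `k` vectors -/

section Operator

variable {𝕜 : Type*} [RCLike 𝕜] {E : Type*} [NormedAddCommGroup E] [InnerProductSpace 𝕜 E]
  [FiniteDimensional 𝕜 E] {T : E →ₗ[𝕜] E} {n : ℕ}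

/-- **Deflation, upper form.** If `re ⟪T x, x⟫ ≤ μ ‖x‖²` for every `x` orthogonal to `k` given vectors
`v₀, …, v_{k-1}`, then `λ_i ≤ μ` for every index `i ≥ k` of the antitone enumeration `λ₀ ≥ λ₁ ≥ …`: the orthogonal
complement of `span {v_j}` has dimension `≥ n − k ≥ n − i`, and the min–max half of Courant–Fischer applies.
(Mirror of the tree's `le_eigenvalues_of_forall_orthogonal`.) [cite: HornJohnson2013, Cor 4.3.9] -/
theorem eigenvalues_le_of_forall_orthogonal (hT : T.IsSymmetric) (hn : finrank 𝕜 E = n) {k : ℕ}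
    (v : Fin k → E) {μ : ℝ}
    (hμ : ∀ x : E, (∀ j, ⟪v j, x⟫_𝕜 = 0) → RCLike.re ⟪T x, x⟫_𝕜 ≤ μ * ‖x‖ ^ 2)
    (i : Fin n) (hi : k ≤ (i : ℕ)) : hT.eigenvalues hn i ≤ μ := by
  classical
  set V : Submodule 𝕜 E := Submodule.span 𝕜 (Set.range v) with hV
  have hVk : finrank 𝕜 V ≤ k := by
    have h := finrank_range_le_card (R := 𝕜) v
    simpa [Set.finrank, hV] using h
  have hW : n ≤ finrank 𝕜 Vᗮ + i := by
    have h := V.finrank_add_finrank_orthogonal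
    rw [hn] at h
    omega
  refine eigenvalues_le_of_forall_mem hT hn i Vᗮ hW fun x hx => hμ x fun j => ?_
  exact (Submodule.mem_orthogonal V x).1 hx (v j) (Submodule.subset_span ⟨j, rfl⟩)

end Operator

/-! ### §2 Matrix forms for `Matrix.IsHermitian.eigenvalues₀` (antitone: `λ↓₀ ≥ λ↓₁ ≥ …`) -/

section MatrixForms

variable {𝕜 : Type*} [RCLike 𝕜] {m ι k : Type*} [Fintype m] [DecidableEq m] [Fintype ι] [Fintype k]

/-- **Deflation certificate for the LARGEST eigenvalues (matrix form).** Let `A` be Hermitian. If for some real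
`μ`, vectors `v₀, …, v_{k-1}` and ANY real coefficients `c_j` the matrix `μ·1 − A + Σ_j c_j · v_j v_jᴴ` is positive
semidefinite, then `λ↓_i(A) ≤ μ` for every `i ≥ k`; in particular `μ` bounds the `(k+1)`-th largest eigenvalue
from above.  This is lineage A's «shifted-Cholesky positive-definiteness upper bound» with `v_j` = the leading float
Ritz vectors and `c_j = τ' ≥ 0` (ENGINE.md §3 (iii); `kit_build.py:cert_eigs` step (2)).
[cite: HornJohnson2013, Cor 4.3.9] -/
theorem eigenvalues₀_le_of_deflation_posSemidef {A : Matrix m m 𝕜} (hA : A.IsHermitian) {k : ℕ}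
    (v : Fin k → m → 𝕜) (c : Fin k → ℝ) {μ : ℝ}
    (hpsd : ((μ : 𝕜) • (1 : Matrix m m 𝕜) - A +
      ∑ j, ((c j : ℝ) : 𝕜) • vecMulVec (v j) (star (v j))).PosSemidef)
    (i : Fin (Fintype.card m)) (hi : k ≤ (i : ℕ)) :
    hA.eigenvalues₀ i ≤ μ := by
  have hT : (toEuclideanLin A).IsSymmetric := isSymmetric_toEuclideanLin_iff.mpr hA
  change hT.eigenvalues finrank_euclideanSpace i ≤ μ
  refine eigenvalues_le_of_forall_orthogonal hT finrank_euclideanSpace (fun j => toLp 2 (v j)) ?_ i hi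
  intro x hx
  have hx' : ∀ j, star (v j) ⬝ᵥ ofLp x = 0 := fun j => by
    have h := hx j
    rw [EuclideanSpace.inner_eq_star_dotProduct, dotProduct_comm] at h
    exact h
  have h0 := hpsd.dotProduct_mulVec_nonneg (ofLp x)
  rw [add_mulVec, sub_mulVec, smul_mulVec, one_mulVec, Matrix.sum_mulVec, dotProduct_add,
    dotProduct_sub, dotProduct_smul, dotProduct_sum] at h0
  have hvan : ∑ j, star (ofLp x) ⬝ᵥ ((((c j : ℝ) : 𝕜) • vecMulVec (v j) (star (v j))) *ᵥ ofLp x) = 0 := by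
    refine Finset.sum_eq_zero fun j _ => ?_
    rw [smul_mulVec, dotProduct_smul, star_dotProduct_vecMulVec_mulVec, hx' j, mul_zero, smul_zero]
  rw [hvan, add_zero, smul_eq_mul, star_dotProduct_self_euclidean, RCLike.nonneg_iff, map_sub,
    ← RCLike.ofReal_mul, RCLike.ofReal_re] at h0
  rw [hT x x, inner_self_toEuclideanLin]
  linarith [h0.1]

/-- **Rayleigh–Ritz certificate for the LARGEST eigenvalues (matrix form).** Let `A` be Hermitian,
`W : Matrix m ι 𝕜` a family of `|ι|` trial columns with positive definite Gram matrix `Wᴴ W` (linear independence —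
orthonormality is NOT required), and `σ` real with `Wᴴ A W − σ · Wᴴ W ⪰ 0` (every Ritz value of the pencil
`(Wᴴ A W, Wᴴ W)` is `≥ σ`). Then `σ ≤ λ↓_i(A)` for every `i` with `i + 1 ≤ |ι|`; in particular `σ` is a lower
bound for the `|ι|`-th largest eigenvalue.  This is lineage A's «k × k Rayleigh–Ritz lower bound» on the leading
float eigenvectors (ENGINE.md §3 (iii); `cert_eigs` step (1): the float vectors are only nearly orthonormal, whence
the pencil). [cite: HornJohnson2013, Thm 4.3.21] -/
theorem le_eigenvalues₀_of_ritz_posSemidef {A : Matrix m m 𝕜} (hA : A.IsHermitian) (W : Matrix m ι 𝕜)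
    (hG : (Wᴴ * W).PosDef) {σ : ℝ} (hpsd : (Wᴴ * A * W - (σ : 𝕜) • (Wᴴ * W)).PosSemidef)
    (i : Fin (Fintype.card m)) (hi : (i : ℕ) + 1 ≤ Fintype.card ι) :
    σ ≤ hA.eigenvalues₀ i := by
  have hT : (toEuclideanLin A).IsSymmetric := isSymmetric_toEuclideanLin_iff.mpr hA
  change σ ≤ hT.eigenvalues finrank_euclideanSpace i
  -- the trial map `a ↦ W a` into `EuclideanSpace 𝕜 m`
  let f : (ι → 𝕜) →ₗ[𝕜] EuclideanSpace 𝕜 m :=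
    (WithLp.linearEquiv 2 𝕜 (m → 𝕜)).symm.toLinearMap ∘ₗ Matrix.mulVecLin W
  have hf : ∀ a, f a = toLp 2 (W *ᵥ a) := fun a => rfl
  have hinj : Function.Injective f := by
    rw [← LinearMap.ker_eq_bot, Submodule.eq_bot_iff]
    intro a ha
    rw [LinearMap.mem_ker, hf] at ha
    have hWa : W *ᵥ a = 0 := by simpa using congrArg ofLp ha
    by_contra h0
    have hpos := hG.dotProduct_mulVec_pos h0
    rw [← mulVec_mulVec, hWa, mulVec_zero, dotProduct_zero] at hpos
    exact lt_irrefl _ hpos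
  have hdim : finrank 𝕜 (LinearMap.range f) = Fintype.card ι := by
    rw [LinearMap.finrank_range_of_inj hinj, finrank_fintype_fun_eq_card]
  refine le_eigenvalues_of_forall_mem hT finrank_euclideanSpace i (LinearMap.range f)
    (by rw [hdim]; omega) fun x hx => ?_
  obtain ⟨a, rfl⟩ := LinearMap.mem_range.1 hx
  have h0 := hpsd.dotProduct_mulVec_nonneg a
  rw [sub_mulVec, smul_mulVec, dotProduct_sub, dotProduct_smul, smul_eq_mul, ← mulVec_mulVec,
    ← mulVec_mulVec, ← mulVec_mulVec, dotProduct_mulVec (star a) Wᴴ, ← star_mulVec,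
    dotProduct_mulVec (star a) Wᴴ, ← star_mulVec] at h0
  rw [hT (f a) (f a), inner_self_toEuclideanLin, hf]
  have hnorm : star (W *ᵥ a) ⬝ᵥ (W *ᵥ a) = ((‖toLp 2 (W *ᵥ a)‖ ^ 2 : ℝ) : 𝕜) :=
    star_dotProduct_self_euclidean (toLp 2 (W *ᵥ a))
  change σ * ‖toLp 2 (W *ᵥ a)‖ ^ 2 ≤ RCLike.re (star (W *ᵥ a) ⬝ᵥ (A *ᵥ (W *ᵥ a)))
  rw [hnorm, RCLike.nonneg_iff, map_sub, ← RCLike.ofReal_mul, RCLike.ofReal_re] at h0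
  linarith [h0.1]

/-- **Loewner monotonicity of the sorted eigenvalues** (`A ⪯ B ⇒ λ↓_i(A) ≤ λ↓_i(B)` for every `i`): the
eigenvalue half of lineage A's BRACKETING builds `G⁻ ⪯ G ⪯ G⁺` (ENGINE.md §3 (ii): the two builds with plaquette
coefficients `w ∓ τ` sandwich the true Galerkin matrix in the Loewner order because the plaquette weight is a
non-negative multiplication operator). [cite: HornJohnson2013, Cor 4.3.12] -/
theorem eigenvalues₀_mono {A B : Matrix m m 𝕜} (hA : A.IsHermitian) (hB : B.IsHermitian)
    (hAB : (B - A).PosSemidef) (i : Fin (Fintype.card m)) :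
    hA.eigenvalues₀ i ≤ hB.eigenvalues₀ i := by
  have hT : (toEuclideanLin B).IsSymmetric := isSymmetric_toEuclideanLin_iff.mpr hB
  have hS : (toEuclideanLin A).IsSymmetric := isSymmetric_toEuclideanLin_iff.mpr hA
  change hS.eigenvalues finrank_euclideanSpace i ≤ hT.eigenvalues finrank_euclideanSpace i
  have hc : ∀ x : EuclideanSpace 𝕜 m,
      RCLike.re ⟪(toEuclideanLin A - toEuclideanLin B) x, x⟫_𝕜 ≤ 0 * ‖x‖ ^ 2 := by
    intro x
    have h0 := hAB.dotProduct_mulVec_nonneg (ofLp x)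
    have hsym : (toEuclideanLin (B - A)).IsSymmetric := isSymmetric_toEuclideanLin_iff.mpr (hB.sub hA)
    have e : toEuclideanLin A - toEuclideanLin B = -(toEuclideanLin (B - A)) := by
      rw [map_sub]; abel
    rw [zero_mul, e, LinearMap.neg_apply, inner_neg_left, map_neg, neg_nonpos, hsym x x,
      inner_self_toEuclideanLin]
    rw [RCLike.nonneg_iff] at h0
    exact h0.1
  have h := eigenvalues_le_eigenvalues_add_of_re_inner_sub_le hT hS finrank_euclideanSpace hc i
  linarith

/-- The BRACKETING sandwich: `G⁻ ⪯ G ⪯ G⁺ ⇒ λ↓_i(G⁻) ≤ λ↓_i(G) ≤ λ↓_i(G⁺)` for every `i` — a certified lower bound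
for `G⁻` and a certified upper bound for `G⁺` enclose the eigenvalues of the (never assembled) exact `G`.
[cite: HornJohnson2013, Cor 4.3.12] -/
theorem eigenvalues₀_sandwich {Gm G Gp : Matrix m m 𝕜} (hGm : Gm.IsHermitian) (hG : G.IsHermitian)
    (hGp : Gp.IsHermitian) (hlo : (G - Gm).PosSemidef) (hhi : (Gp - G).PosSemidef)
    (i : Fin (Fintype.card m)) :
    hGm.eigenvalues₀ i ≤ hG.eigenvalues₀ i ∧ hG.eigenvalues₀ i ≤ hGp.eigenvalues₀ i :=
  ⟨eigenvalues₀_mono hGm hG hlo i, eigenvalues₀_mono hG hGp hhi i⟩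

/-- **Build-rounding transport (Schur test + Weyl).** If `G` and `M` are Hermitian and the build error is dominated
entrywise, `‖(G − M) i j‖ ≤ N i j`, by a real matrix `N` whose row sums and column sums are `≤ errG`, then
`|λ↓_i(G) − λ↓_i(M)| ≤ errG` for every `i` (`‖G − M‖₂ ≤ ‖N‖₂ ≤ √(‖N‖₁ ‖N‖_∞) ≤ errG`).  Lineage A: `N = c·u·Mabs`
from the parallel `|·|`-accumulation, `errG = ‖N‖_∞` (ENGINE.md §3 (iii); `cert_eigs` step (0)).
[cite: HornJohnson2013, Thm 4.3.1] -/
theorem abs_eigenvalues₀_sub_le_of_entrywise {G M : Matrix m m 𝕜} (hG : G.IsHermitian) (hM : M.IsHermitian)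
    (N : Matrix m m ℝ) (hdom : ∀ i j, ‖(G - M) i j‖ ≤ N i j) {errG : ℝ} (hrow : ∀ i, ∑ j, N i j ≤ errG)
    (hcol : ∀ j, ∑ i, N i j ≤ errG) (i : Fin (Fintype.card m)) :
    |hG.eigenvalues₀ i - hM.eigenvalues₀ i| ≤ errG := by
  have hT : (toEuclideanLin M).IsSymmetric := isSymmetric_toEuclideanLin_iff.mpr hM
  have hS : (toEuclideanLin G).IsSymmetric := isSymmetric_toEuclideanLin_iff.mpr hG
  change |hS.eigenvalues finrank_euclideanSpace i - hT.eigenvalues finrank_euclideanSpace i| ≤ errG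
  refine abs_eigenvalues_sub_eigenvalues_le hT hS finrank_euclideanSpace (fun x => ?_) i
  have h := norm_star_dotProduct_mulVec_le_of_norm_le_rowSum_colSum (G - M) N hdom hrow hcol (ofLp x)
  have hsym : (toEuclideanLin (G - M)).IsSymmetric := isSymmetric_toEuclideanLin_iff.mpr (hG.sub hM)
  rw [← map_sub, hsym x x, inner_self_toEuclideanLin]
  have hn2 : ∑ l, ‖(ofLp x) l‖ ^ 2 = ‖x‖ ^ 2 := by
    rw [EuclideanSpace.norm_eq, Real.sq_sqrt (Finset.sum_nonneg fun l _ => by positivity)]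
  rw [← hn2]
  exact (RCLike.abs_re_le_norm _).trans h

/-- **The shifted-Cholesky step.** If `C` is Hermitian and some factor `R` (e.g. a floating-point Cholesky factor of
`C − δ·1`) has an entrywise dominated residual `‖(C − δ·1 − Rᴴ R) i j‖ ≤ N i j` with row sums and column sums of `N`
at most `r ≤ δ`, then `C ⪰ 0` (indeed `C ⪰ (δ − r)·1`).  This is `kit_build.py:posdef_certified` (the entrywise bound
`N = |C_δ − RᵀR| + γ_{n+2}|R|ᵀ|R|` is Higham Thm. 10.3 and is the hypothesis `hdom` here).
[cite: Rump2006, Thm 2.3] -/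
theorem posSemidef_of_shifted_factor_residual {C : Matrix m m 𝕜} (hC : C.IsHermitian) (R : Matrix k m 𝕜)
    (N : Matrix m m ℝ) {δ r : ℝ} (hdom : ∀ i j, ‖(C - (δ : 𝕜) • (1 : Matrix m m 𝕜) - Rᴴ * R) i j‖ ≤ N i j)
    (hrow : ∀ i, ∑ j, N i j ≤ r) (hcol : ∀ j, ∑ i, N i j ≤ r) (hrδ : r ≤ δ) : C.PosSemidef := by
  have hB : (C - (δ : 𝕜) • (1 : Matrix m m 𝕜)).IsHermitian := by
    refine hC.sub ?_
    rw [IsHermitian, conjTranspose_smul, conjTranspose_one, RCLike.star_def, RCLike.conj_ofReal]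
  have h1 := posSemidef_add_of_residual_le_rowSum hB R N hdom hrow hcol
  -- `C = (C − δ·1 + r·1) + (δ − r)·1`
  have h2 : (((δ - r : ℝ) : 𝕜) • (1 : Matrix m m 𝕜)).PosSemidef := by
    refine PosSemidef.of_dotProduct_mulVec_nonneg ?_ fun v => ?_
    · rw [IsHermitian, conjTranspose_smul, conjTranspose_one, RCLike.star_def, RCLike.conj_ofReal]
    · rw [smul_mulVec, one_mulVec, dotProduct_smul, smul_eq_mul, star_dotProduct_self_eq_ofReal_sum,
        ← RCLike.ofReal_mul, RCLike.ofReal_nonneg]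
      exact mul_nonneg (by linarith) (Finset.sum_nonneg fun l _ => by positivity)
  have hsum : C = (C - (δ : 𝕜) • (1 : Matrix m m 𝕜) + (r : 𝕜) • (1 : Matrix m m 𝕜)) +
      ((δ - r : ℝ) : 𝕜) • (1 : Matrix m m 𝕜) := by
    rw [RCLike.ofReal_sub, sub_smul]; abel
  rw [hsum]
  exact h1.add h2

/-- **Transport of a PSD certificate through an entrywise-dominated perturbation.**  If `C'` (e.g. the matrix
actually FORMED in floating point) satisfies `C' − r·1 ⪰ 0` and `‖(C − C') i j‖ ≤ N i j` with row sums and column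
sums of `N` at most `r`, then the intended (exact) matrix `C` is positive semidefinite.  This is the last line of
`cert_eigs` step (2): «posdef of fl(Cm) − dC_norm·I certifies Cm_exact ⪰ 0». [folklore] -/
theorem posSemidef_of_entrywise_close {C C' : Matrix m m 𝕜} (hC : C.IsHermitian) (hC' : C'.IsHermitian)
    (N : Matrix m m ℝ) (hdom : ∀ i j, ‖(C - C') i j‖ ≤ N i j) {r : ℝ} (hrow : ∀ i, ∑ j, N i j ≤ r)
    (hcol : ∀ j, ∑ i, N i j ≤ r) (hpsd : (C' - (r : 𝕜) • (1 : Matrix m m 𝕜)).PosSemidef) : C.PosSemidef := by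
  have hB : (C - C').IsHermitian := hC.sub hC'
  have hdom' : ∀ i j, ‖(C - C' - (0 : Matrix m m 𝕜)ᴴ * (0 : Matrix m m 𝕜)) i j‖ ≤ N i j := by
    intro i j
    rw [conjTranspose_zero, Matrix.zero_mul, sub_zero]
    exact hdom i j
  have h1 := posSemidef_add_of_residual_le_rowSum hB (0 : Matrix m m 𝕜) N hdom' hrow hcol
  have hsum : C = (C' - (r : 𝕜) • (1 : Matrix m m 𝕜)) + (C - C' + (r : 𝕜) • (1 : Matrix m m 𝕜)) := by abel
  rw [hsum]
  exact hpsd.add h1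

/-- **ASSEMBLY — lineage A's block enclosure.** Exact Galerkin block `G` (Hermitian), float build `M` (Hermitian)
with `|G − M| ≤ N` entrywise, row/column sums of `N` at most `errG`; a Rayleigh–Ritz certificate
`Wᴴ M W − σ · Wᴴ W ⪰ 0` on `|ι| ≥ i + 1` independent trial columns; a deflation certificate
`μ·1 − M + Σ_{j<k} c_j · v_j v_jᴴ ⪰ 0` with `k ≤ i` vectors.  Then `σ − errG ≤ λ↓_i(G) ≤ μ + errG`: the `[lo, hi]`
of a task JSON's block before the bracketing / tail terms. [cite: HornJohnson2013, Thm 4.2.6; Thm 4.3.1] -/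
theorem block_enclosure {G M : Matrix m m 𝕜} (hG : G.IsHermitian) (hM : M.IsHermitian)
    (N : Matrix m m ℝ) (hdom : ∀ i j, ‖(G - M) i j‖ ≤ N i j) {errG : ℝ} (hrow : ∀ i, ∑ j, N i j ≤ errG)
    (hcol : ∀ j, ∑ i, N i j ≤ errG)
    (W : Matrix m ι 𝕜) (hW : (Wᴴ * W).PosDef) {σ : ℝ} (hritz : (Wᴴ * M * W - (σ : 𝕜) • (Wᴴ * W)).PosSemidef)
    {k : ℕ} (v : Fin k → m → 𝕜) (c : Fin k → ℝ) {μ : ℝ}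
    (hdefl : ((μ : 𝕜) • (1 : Matrix m m 𝕜) - M + ∑ j, ((c j : ℝ) : 𝕜) • vecMulVec (v j) (star (v j))).PosSemidef)
    (i : Fin (Fintype.card m)) (hιi : (i : ℕ) + 1 ≤ Fintype.card ι) (hki : k ≤ (i : ℕ)) :
    σ - errG ≤ hG.eigenvalues₀ i ∧ hG.eigenvalues₀ i ≤ μ + errG := by
  have hw := abs_le.1 (abs_eigenvalues₀_sub_le_of_entrywise hG hM N hdom hrow hcol i)
  have hlo := le_eigenvalues₀_of_ritz_posSemidef hM W hW hritz i hιi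
  have hhi := eigenvalues₀_le_of_deflation_posSemidef hM v c hdefl i hki
  constructor <;> linarith [hw.1, hw.2]

/-- **BRACKETED block enclosure** (the two builds of ENGINE.md §3 (ii)–(iii) together).  The exact kept-set block
`G` is never assembled; the engine builds float matrices `Mm ≈ Gm` and `Mp ≈ Gp` of the two BRACKETING operators
`Gm ⪯ G ⪯ Gp` (plaquette coefficients `w ∓ τ`), certifies a Rayleigh–Ritz lower bound `σ` on `Mm` and a deflation
upper bound `μ` on `Mp` with their build-rounding radii `errGm`, `errGp`.  Then
`σ − errGm ≤ λ↓_i(G) ≤ μ + errGp` — the `[lo_k(G⁻), hi_k(G⁺)]` of the task JSON.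
[cite: HornJohnson2013, Thm 4.2.6; Thm 4.3.1; Cor 4.3.12] -/
theorem bracketed_block_enclosure {Gm G Gp Mm Mp : Matrix m m 𝕜} (hGm : Gm.IsHermitian) (hG : G.IsHermitian)
    (hGp : Gp.IsHermitian) (hMm : Mm.IsHermitian) (hMp : Mp.IsHermitian)
    (hlo : (G - Gm).PosSemidef) (hhi : (Gp - G).PosSemidef)
    (Nm : Matrix m m ℝ) (hdomm : ∀ i j, ‖(Gm - Mm) i j‖ ≤ Nm i j) {errGm : ℝ}
    (hrowm : ∀ i, ∑ j, Nm i j ≤ errGm) (hcolm : ∀ j, ∑ i, Nm i j ≤ errGm)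
    (Np : Matrix m m ℝ) (hdomp : ∀ i j, ‖(Gp - Mp) i j‖ ≤ Np i j) {errGp : ℝ}
    (hrowp : ∀ i, ∑ j, Np i j ≤ errGp) (hcolp : ∀ j, ∑ i, Np i j ≤ errGp)
    (W : Matrix m ι 𝕜) (hW : (Wᴴ * W).PosDef) {σ : ℝ} (hritz : (Wᴴ * Mm * W - (σ : 𝕜) • (Wᴴ * W)).PosSemidef)
    {k : ℕ} (v : Fin k → m → 𝕜) (c : Fin k → ℝ) {μ : ℝ}
    (hdefl : ((μ : 𝕜) • (1 : Matrix m m 𝕜) - Mp +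
      ∑ j, ((c j : ℝ) : 𝕜) • vecMulVec (v j) (star (v j))).PosSemidef)
    (i : Fin (Fintype.card m)) (hιi : (i : ℕ) + 1 ≤ Fintype.card ι) (hki : k ≤ (i : ℕ)) :
    σ - errGm ≤ hG.eigenvalues₀ i ∧ hG.eigenvalues₀ i ≤ μ + errGp := by
  have hs := eigenvalues₀_sandwich hGm hG hGp hlo hhi i
  have hwm := (abs_le.1 (abs_eigenvalues₀_sub_le_of_entrywise hGm hMm Nm hdomm hrowm hcolm i)).1
  have hwp := (abs_le.1 (abs_eigenvalues₀_sub_le_of_entrywise hGp hMp Np hdomp hrowp hcolp i)).2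
  have hl := le_eigenvalues₀_of_ritz_posSemidef hMm W hW hritz i hιi
  have hu := eigenvalues₀_le_of_deflation_posSemidef hMp v c hdefl i hki
  constructor <;> linarith [hs.1, hs.2]

/-- **ROW ENCLOSURE** — composition with the kinetic-truncation tail.  The tail theorem (ENGINE.md §3 (i) = the typed
`KWeightTail.eigenvalues₀_mem_Icc`: `λ↓_i(T̂) ∈ [λ↓_i(G), λ↓_i(G) + κ_T Ω]` for the kept-set compression `G` of the
sector operator `T̂`) is taken here as its real-number conclusion `t ∈ [g, g + slack]` about `t = λ↓_i(T̂)` and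
`g = λ↓_i(G)`; with the bracketed block enclosure `g ∈ [lo, hi]` the published interval is `[lo, hi + slack]`.
[folklore] -/
theorem row_enclosure {t g lo hi slack : ℝ} (htail : t ∈ Set.Icc g (g + slack)) (hblock : lo ≤ g ∧ g ≤ hi) :
    t ∈ Set.Icc lo (hi + slack) :=
  ⟨hblock.1.trans htail.1, htail.2.trans (by linarith [hblock.2])⟩

end MatrixForms

end RitzDeflation

end Summit.Ventures.YMGap.FlowData

end
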